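import Summits.ValiantsHypothesis.ValiantsHypothesis.Theorems.KPlusLogSqLawTropicalBTopHeavyCoreTransferSums

/-!
# Route «KPlusLogSqLaw», crux `TropicalB` (stmt-ValiantsHypothesis-19771) — THE SWAP LAW: a one-column raise plus any number of
# `c₁ ↔ c₂` swaps with MORE lowerings than raisings, against a later `c₀`-heavy term (all `m`, all arrangements, inert columns free)

HONEST FRAMING.  Helper file (cell `pub-symmetroid`, seat val-sym-trop-p1 g23, 2026-08-29; `--supports stmt-ValiantsHypothesis-19771 --as
helper`), sequel of …TopHeavyCoreTransferSums (same seat).  A census-STRUCTURE law of the κ-programme (3-body obstruction on dominant terms of an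
arbitrary dominance design); nothing here bounds `TropicalB` in its window and nothing bears on `WeakLifting`, DoorA26 / DoorA34, `MatrixDescartes`
(stmt-ValiantsHypothesis-18050) or VP ≠ VNP.  As for every law sharing the `C`-histogram `c₀^{m−1}c₄` with CORE LAW C, no new deficient census cell
follows; the content is structural (it constrains ARRANGEMENTS of dominant terms, e.g. for construction searches).

THE SWAP LAW (`transfer_swaps`).  Classes `d c₀ < d c₁ < d c₂`.  Dominant `P_A = (σA, λA)`, `P_B = (σB, λB)`, `P_C = (σC, λC)` with `P_C` LATEST,
`λC ≡ c₀` off one column `c`, `d c₀ ≤ d (λC ·)`, and all classes of `P_A`, `P_B` of exponent `> d c₀` (otherwise ARBITRARY — inert columns, where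
`λA = λB`, may carry any classes).  Suppose that off one column `s` the two class functions differ only by `c₁ ↔ c₂` SWAPS — a set `X` of columns
raised `c₁ → c₂` and a set `Y` lowered `c₂ → c₁` — with `#X + 1 ≤ #Y`, and that at `s` the class is RAISED to exponent at least `d c₂`
(`d (λA s) < d (λB s)`, `d c₂ ≤ d (λB s)`).  Then the three terms are not all dominant.  Proof: `transfer_of_sums` with (B1) `b = s`; (A2) by the
count «off `s`, `r = (d c₂ − d c₁)·([· ∈ X] − [· ∈ Y])`, `#X < #Y`, and every `Y`-column off the arc has `A`-surplus `≥ d c₂ − d c₁`»; (A3) with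
`L = {x : d (λA x) < d c₂}`.  SPECIAL CASES: `X = ∅`, `#Y = 1` is the one-column transfer law of …TopHeavyCoreGeneral/…Budget (there with the sharper
budget hypothesis); `X = {p}`, `Y = Q` is `two_raised_transfer`; two-valued `λA`, `λB` is `transfer_twoValued(_count)`; NEW: arbitrary inert columns
(any classes, e.g. `c₃`, `c₄` columns of `A` kept in `B`) and any number of balanced extra swaps — in transfer language
`B = A + (t+1)(c₁ − c₂) + (λB s − λA s)` for every `t ≥ #X`, e.g. the (2,2)→(1,3) transfer `B = A − 2c₂ + c₁ + c₃` for an ARBITRARY `A ∋ c₂, c₂` in every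
arrangement whose other changed columns are `c₁ ↔ c₂` swaps with lowerings in the majority (memo HOME/val-sym-trop-p1/g21/CORE-LAW-C-g21.md §6).
[this cell; combinatorics folklore]
-/

set_option linter.dupNamespace false
set_option autoImplicit false

namespace Summit.ValiantsHypothesis.ValiantsHypothesis.Theorems.KPlusLogSqLaw.TopHeavyCore

open Summit.ValiantsHypothesis.ValiantsHypothesis.Theorems.MatrixDescartes.Negative
open scoped BigOperators
open Finset

variable {m K : ℕ}

/-- counting: for `j ∈ U` and `#X + 1 ≤ #Y`, `#(U∖{j} ∩ X) − #(U∖{j} ∩ Y) ≤ #(Uᶜ ∩ Y)` (split `Y` over `U∖{j}`, `{j}`, `Uᶜ`). [folklore] -/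
theorem count_swaps (U X Y : Finset (Fin m)) {j : Fin m} (hjU : j ∈ U) (hXY : X.card + 1 ≤ Y.card) :
    ((U.erase j ∩ X).card : ℤ) - ((U.erase j ∩ Y).card : ℤ) ≤ ((Uᶜ ∩ Y).card : ℤ) := by
  classical
  have cY := card_split_erase U Y hjU
  have hX : ((U.erase j ∩ X).card : ℤ) ≤ X.card := by exact_mod_cast card_le_card inter_subset_right
  have hj : (if j ∈ Y then (1 : ℤ) else 0) ≤ 1 := by split_ifs <;> norm_num
  have hXY' : (X.card : ℤ) + 1 ≤ Y.card := by exact_mod_cast hXY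
  linarith

/-- **THE SWAP LAW.**  See the module docstring. [this cell] -/
theorem transfer_swaps (d : Fin K → ℕ) (v ε : Fin m → Fin m → Fin K → ℤ)
    {c₀ c₁ c₂ : Fin K} (h01 : d c₀ < d c₁) (h12 : d c₁ < d c₂)
    {σA σB σC : Equiv.Perm (Fin m)} {lA lB lC : Fin m → Fin K} {s c : Fin m}
    (hlowA : ∀ x, d c₀ < d (lA x)) (hlowB : ∀ x, d c₀ < d (lB x))
    (hswap : ∀ x, x ≠ s → lA x ≠ lB x → (lA x = c₁ ∧ lB x = c₂) ∨ (lA x = c₂ ∧ lB x = c₁))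
    (hcount : (univ.filter fun x => x ≠ s ∧ lA x = c₁ ∧ lB x = c₂).card + 1 ≤
      (univ.filter fun x => x ≠ s ∧ lA x = c₂ ∧ lB x = c₁).card)
    (hs : d (lA s) < d (lB s)) (hs2 : d c₂ ≤ d (lB s))
    (hlC : ∀ x, x ≠ c → lC x = c₀) (hCge : ∀ x, d c₀ ≤ d (lC x))
    {θA θB θC : ℤ} (hA : IsDominant d v ε θA (σA, lA)) (hB : IsDominant d v ε θB (σB, lB)) (hC : IsDominant d v ε θC (σC, lC))
    (hAC : θA < θC) (hBC : θB < θC) : False := by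
  classical
  set X : Finset (Fin m) := univ.filter fun x => x ≠ s ∧ lA x = c₁ ∧ lB x = c₂ with hXdef
  set Y : Finset (Fin m) := univ.filter fun x => x ≠ s ∧ lA x = c₂ ∧ lB x = c₁ with hYdef
  set δ : ℤ := (d c₂ : ℤ) - d c₁ with hδ
  have hδpos : 0 < δ := by rw [hδ]; have : (d c₁ : ℤ) < d c₂ := (by exact_mod_cast h12); linarith
  have h01z : (d c₀ : ℤ) < d c₁ := by exact_mod_cast h01
  have memX : ∀ x, x ∈ X ↔ x ≠ s ∧ lA x = c₁ ∧ lB x = c₂ := fun x => by rw [hXdef, mem_filter]; simp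
  have memY : ∀ x, x ∈ Y ↔ x ≠ s ∧ lA x = c₂ ∧ lB x = c₁ := fun x => by rw [hYdef, mem_filter]; simp
  -- off `s`, the raise is `δ·([· ∈ X] − [· ∈ Y])`
  have hr : ∀ x, x ≠ s → (d (lB x) : ℤ) - d (lA x) = δ * ((if x ∈ X then (1 : ℤ) else 0) - (if x ∈ Y then (1 : ℤ) else 0)) := by
    intro x hxs
    by_cases hX : x ∈ X
    · obtain ⟨-, hA1, hB2⟩ := (memX x).mp hX
      have hY : x ∉ Y := fun h => by
        obtain ⟨-, hA2, -⟩ := (memY x).mp h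
        rw [hA1] at hA2; rw [hA2] at h12; exact lt_irrefl _ h12
      rw [if_pos hX, if_neg hY, hA1, hB2, hδ]; ring
    · by_cases hY : x ∈ Y
      · obtain ⟨-, hA2, hB1⟩ := (memY x).mp hY
        rw [if_neg hX, if_pos hY, hA2, hB1, hδ]; ring
      · -- inert column
        have heq : lA x = lB x := by
          by_contra hne
          rcases hswap x hxs hne with ⟨h1, h2⟩ | ⟨h1, h2⟩
          · exact hX ((memX x).mpr ⟨hxs, h1, h2⟩)
          · exact hY ((memY x).mpr ⟨hxs, h1, h2⟩)
        rw [if_neg hX, if_neg hY, heq]; ring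
  have hsur0 : ∀ x, (0 : ℤ) ≤ (d (lA x) : ℤ) - d c₀ := fun x => by
    have : (d c₀ : ℤ) ≤ d (lA x) := (by exact_mod_cast (hlowA x).le); linarith
  have hsurY : ∀ x, x ∈ Y → δ ≤ (d (lA x) : ℤ) - d c₀ := fun x hx => by
    obtain ⟨-, hA2, -⟩ := (memY x).mp hx
    rw [hA2, hδ]; linarith
  -- a lowered column
  have hYne : Y.Nonempty := by
    rw [← card_pos]; omega
  obtain ⟨y, hyY⟩ := hYne
  obtain ⟨hys, hAy, hBy⟩ := (memY y).mp hyY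
  have hylow : d (lB y) < d (lA y) := by rw [hAy, hBy]; exact h12
  -- bounds on single raises / deficits off `s`
  have hr_le : ∀ x, x ≠ s → (d (lB x) : ℤ) - d (lA x) ≤ δ := fun x hx => by
    rw [hr x hx]
    have : ((if x ∈ X then (1 : ℤ) else 0) - (if x ∈ Y then (1 : ℤ) else 0)) ≤ 1 := by split_ifs <;> norm_num
    nlinarith
  have hdef_le : ∀ x, x ≠ s → (d (lA x) : ℤ) - d (lB x) ≤ δ := fun x hx => by
    rw [show (d (lA x) : ℤ) - d (lB x) = -((d (lB x) : ℤ) - d (lA x)) by ring, hr x hx]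
    have : -(((if x ∈ X then (1 : ℤ) else 0) - (if x ∈ Y then (1 : ℤ) else 0))) ≤ 1 := by split_ifs <;> norm_num
    nlinarith
  have hsz : (d (lA s) : ℤ) < d (lB s) := by exact_mod_cast hs
  have hs2z : (d c₂ : ℤ) ≤ d (lB s) := by exact_mod_cast hs2
  refine transfer_of_sums d v ε (s := s) hlC hCge hlowA hlowB hA hB hC hAC hBC hs ⟨s, hs, fun j => ?_⟩ ?_
    ⟨univ.filter (fun x => d (lA x) < d c₂), ⟨y, by rw [mem_filter, hAy]; simp, hylow⟩, ?_⟩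
  · -- (B1) with `b = s`
    by_cases hj : j = s
    · rw [hj]; linarith
    · have := hdef_le j hj; linarith
  · -- (A2) by counting
    intro U j hjU hUne hsS
    have hsum1 : ∑ x ∈ U.erase j, ((d (lB x) : ℤ) - d (lA x)) =
        δ * (((U.erase j ∩ X).card : ℤ) - ((U.erase j ∩ Y).card : ℤ)) := by
      rw [Finset.sum_congr rfl fun x hx => hr x (fun h => hsS (h ▸ hx)), ← Finset.mul_sum, Finset.sum_sub_distrib,
        Finset.sum_boole, Finset.sum_boole, Finset.filter_mem_eq_inter, Finset.filter_mem_eq_inter]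
    have hsum2 : δ * ((Uᶜ ∩ Y).card : ℤ) ≤ ∑ x ∈ Uᶜ, ((d (lA x) : ℤ) - d c₀) := by
      calc δ * ((Uᶜ ∩ Y).card : ℤ) = ∑ x ∈ Uᶜ ∩ Y, δ := by rw [Finset.sum_const, nsmul_eq_mul, mul_comm]
        _ ≤ ∑ x ∈ Uᶜ ∩ Y, ((d (lA x) : ℤ) - d c₀) := Finset.sum_le_sum fun x hx => hsurY x (mem_inter.mp hx).2
        _ ≤ ∑ x ∈ Uᶜ, ((d (lA x) : ℤ) - d c₀) :=
            Finset.sum_le_sum_of_subset_of_nonneg inter_subset_left fun x _ _ => hsur0 x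
    rw [hsum1]
    exact le_trans (mul_le_mul_of_nonneg_left (count_swaps U X Y hjU hcount) hδpos.le) hsum2
  · -- (A3) with `L = {x : d (λA x) < d c₂}`
    intro U j hjU hUne hjs hgood
    have h0 : (0 : ℤ) ≤ ∑ x ∈ Uᶜ, ((d (lA x) : ℤ) - d c₀) := Finset.sum_nonneg fun x _ => hsur0 x
    rcases hgood with hjL | ⟨x, hxU, hxL⟩
    · -- `d (λA j) ≥ d c₂`: `j ∉ X`, so no raise at `j`
      have hjX : j ∉ X := fun h => by
        obtain ⟨-, hA1, -⟩ := (memX j).mp h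
        apply hjL; rw [mem_filter, hA1]; exact ⟨mem_univ _, h12⟩
      rw [hr j hjs, if_neg hjX]
      have : ((0 : ℤ) - (if j ∈ Y then (1 : ℤ) else 0)) ≤ 0 := by split_ifs <;> norm_num
      nlinarith
    · -- a column of `A`-surplus `≥ δ` off the arc
      have hxs : (d c₂ : ℤ) ≤ d (lA x) := by
        have : ¬ d (lA x) < d c₂ := fun h => hxL (by rw [mem_filter]; exact ⟨mem_univ _, h⟩)
        exact_mod_cast not_lt.mp this
      have h1 : δ ≤ ∑ x ∈ Uᶜ, ((d (lA x) : ℤ) - d c₀) := by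
        refine le_trans ?_ (Finset.single_le_sum (f := fun x => (d (lA x) : ℤ) - d c₀) (fun x _ => hsur0 x) (mem_compl.mpr hxU))
        simp only [hδ]; linarith
      linarith [hr_le j hjs]

end Summit.ValiantsHypothesis.ValiantsHypothesis.Theorems.KPlusLogSqLaw.TopHeavyCore
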